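import Summits.BirchSwinnertonDyer.Rank1Residual.P2.CongruentNumberCor515SelmerEight
import Summits.BirchSwinnertonDyer.Rank1Residual.P2.CongruentNumberPairsAtTwoRankZeroOddDescent
import Summits.BirchSwinnertonDyer.Rank1Residual.P2.CongruentNumberPairsAtTwoRankZeroEvenDescent
import HarnessLib

/-!
# Cell `bsd-monsky`, route A: MONSKY 1990 REMARKS (1)–(2) COMPLETED IN THE KERNEL — the auxiliary side «`S̄* = (0)`» of
# Remark (2) on all sixteen cases, and Remark (1)'s four «exceptional» two-prime cases with «`S̄` contains `8` elements»

HONEST FRAMING (cell `bsd-monsky`, run/shared/lean/pub/bsd-monsky/; README §1): ONE theorem on ONE explicit infinite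
family at the prime `2`; nothing is booked by this file; no mark moved. Sequel to `P2/CongruentNumberCor515SelmerEight.lean`
(Remark (2)'s «`S̄ = ℤ/2`» on all twelve Cor. 5.15 families). Monsky 1990, pp. 66–67, verbatim:
Remark (1): «… when `N = p₁p₅` with `(p₁/p₅) = 1`, or `2p₁p₃` with `(p₁/p₃) = 1` or `p₁p₇` with `(p₁/p₇) = 1`, or `2p₁p₇`
with `(p₁/p₇) = 1`, the patient reader may verify that `S̄` contains 8 elements.» Remark (2): «The very patient reader may
verify that `S̄ = ℤ/2` and `S̄* = (0)` precisely when we are in one of the 16 cases listed in Theorems 5.13 and 5.14.»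
Here `S̄ = Sel⁽²⁾(E^{(N)}/ℚ)/E^{(N)}(ℚ)[2]` and `S̄*` the same for the auxiliary `N*` (`2D = NN*`), so «`S̄* = (0)`» is
«`#Sel⁽²⁾(E_{N*}/ℚ) = 4`» and «`#S̄ = 8`» is «`#Sel⁽²⁾(E_N/ℚ) = 32`». The sixteen cases print
`N* = 2, 1, 2, 1, p₃′, 2p₅′, 2, p₃, 2, 1, 2, 2, 1, 1, 1, 2p₅`, i.e. `N* ∈ {1, 2, p₃, 2p₅}`.

* §5 `card_selmerGroup_two_eq_four_and_mordellWeilRank_eq_zero_of_cor515_star` — **`#Sel⁽²⁾(E_{N*}/ℚ) = 4` and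
  `rk E_{N*}(ℚ) = 0` for every auxiliary `N*`** (the landed `#Sel⁽²⁾(E_1) = #Sel⁽²⁾(E_2) = 4`; Heath-Brown's
  one-prime tables `s(p₃) = 0`, `s(2p₅) = 0`; rank `0` from `#Sel⁽²⁾ = 4`). With the sequel's §2: Remark (2) on all
  sixteen cases in the kernel.
* §6 `card_selmerGroup_two_eq_thirtytwo_of_exceptional` — **Remark (1): `#Sel⁽²⁾(E_N/ℚ) = 32` in the four exceptional
  cases** (the odd pair table's complementary kernel count `8`, `s = 3`; the even row `s(2p₁q) = 3`).

UNCONDITIONAL throughout; nothing asserted beyond kernel theorems; no new named fact; no `_holds`.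

References: [Monsky1990MockHeegner] Thms. 5.13–5.14 (pp. 65–66), Remarks (1)–(2) (pp. 66–67);
[HeathBrown1994SelmerCongruentII] §1 (typescript p. 6 L26–L28), Appendix (Monsky) pp. 39–41; [SilvermanAEC2009] Thm. X.4.2.
-/

noncomputable section

open scoped Classical

open Matrix WeierstrassCurve Literature.NumberTheory.EllipticCurves
  Literature.NumberTheory.EllipticCurves.HeathBrown1994
  Literature.NumberTheory.EllipticCurves.Monsky1990
  Literature.NumberTheory.QuadraticFields.RedeiReichardt

set_option autoImplicit false

namespace Summit.BirchSwinnertonDyer.Rank1Residual.P2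

/-! ## §5 Remark (2), the auxiliary side: `S̄* = (0)` — `#Sel⁽²⁾(E_{N*}/ℚ) = 4` and rank `0` for every `N*` of the sixteen cases
(`N* ∈ {1, 2, p₃, 2p₅}`: Thms. 5.13 (1)–(4) and 5.14 (5)–(16) print `N* = 2, 1, 2, 1, p₃′, 2p₅′, 2, p₃, 2, 1, 2, 2, 1, 1, 1, 2p₅`) -/

/-- **MONSKY'S REMARK (2), THE `S̄*` CLAUSE, AS A KERNEL THEOREM: `#Sel⁽²⁾(E_{N*}/ℚ) = 4` («`S̄* = (0)`») and `rk E_{N*}(ℚ) = 0`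
for every auxiliary `N*` of the sixteen cases of Thms. 5.13–5.14** — `N* = 1, 2`, a prime `p₃`, or `2p₅`. UNCONDITIONAL
(the landed counts for `N* = 1, 2`, Heath-Brown's tables `s(p₃) = 0`, `s(2p₅) = 0`; rank `0` from `#Sel⁽²⁾ = 4`).
With §2 this is Remark (2)'s «`S̄ = ℤ/2` and `S̄* = (0)`» on all sixteen cases, in the kernel.
[cite: Monsky1990MockHeegner, Thms. 5.13–5.14 (pp. 65–66), Remark (2) (p. 67)]
[cite: HeathBrown1994SelmerCongruentII, §1 typescript p. 6 L26–L28; Appendix (Monsky) pp. 39–41] [cite: SilvermanAEC2009, Thm. X.4.2] -/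
theorem card_selmerGroup_two_eq_four_and_mordellWeilRank_eq_zero_of_cor515_star {M : ℕ}
    (hM : M = 1 ∨ M = 2 ∨ (M.Prime ∧ M % 8 = 3) ∨ ∃ p : ℕ, p.Prime ∧ p % 8 = 5 ∧ M = 2 * p) :
    Nat.card ((congruentNumberCurve M).selmerGroup 2) = 4 ∧
      (congruentNumberCurve M).mordellWeilRank = 0 := by
  have hM0 : M ≠ 0 := by
    rcases hM with rfl | rfl | ⟨hp, -⟩ | ⟨p, hp, -, rfl⟩
    · exact one_ne_zero
    · exact two_ne_zero
    · exact hp.ne_zero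
    · exact Nat.mul_ne_zero two_ne_zero hp.ne_zero
  have h4 : Nat.card ((congruentNumberCurve M).selmerGroup 2) = 4 := by
    rcases hM with rfl | rfl | ⟨hp, h8⟩ | ⟨p, hp, h8, rfl⟩
    · exact card_selmerGroup_two_congruentNumberCurve_1
    · exact card_selmerGroup_two_congruentNumberCurve_2
    · rw [MonskySelmerParity.card_selmerGroup_two_congruentNumberCurve_prime hp (by omega), if_neg (by omega), if_pos h8]
    · rw [MonskySelmerParity.card_selmerGroup_two_congruentNumberCurve_two_mul_prime hp (by omega), if_neg (by omega),
        if_pos h8]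
  exact ⟨h4, Smith2016.mordellWeilRank_eq_zero_of_card_selmerGroup_two hM0 h4⟩

/-! ## §6 Remark (1): the four «exceptional» two-prime cases have `#S̄ = 8` — `#Sel⁽²⁾(E_N/ℚ) = 32` -/

/-- `#ker M = 8` on a pair (`2·2 − rank M = 3`): Monsky's `s(D) = 2n − rank M` read off a kernel of `8` elements.
[cite: HeathBrown1994SelmerCongruentII, Appendix (Monsky), typescript p. 39 L1–L9 and L33] -/
theorem monskySelmerRankOdd_eq_three_of_card_ker (t : Fin 2 → ℕ)
    (h8 : Fintype.card {z : Fin 2 ⊕ Fin 2 → ZMod 2 // monskyMatrixOdd t *ᵥ z = 0} = 8) :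
    monskySelmerRankOdd t = 3 := by
  have hcard := natCard_ker_mulVecLin_eq (monskyMatrixOdd t)
  have h8' : Nat.card (LinearMap.ker (monskyMatrixOdd t).mulVecLin) = 8 := by
    rw [Nat.card_congr (Equiv.subtypeEquivRight (q := fun v => monskyMatrixOdd t *ᵥ v = 0)
      fun v => by rw [LinearMap.mem_ker, Matrix.mulVecLin_apply]), Nat.card_eq_fintype_card]
    exact h8
  rw [h8', Fintype.card_sum, Fintype.card_fin] at hcard
  have h3 : 2 + 2 - (monskyMatrixOdd t).rank = 3 :=
    Nat.pow_right_injective le_rfl (hcard.symm.trans (by norm_num : (8 : ℕ) = 2 ^ 3))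
  unfold monskySelmerRankOdd
  omega

/-- **Remark (1), the odd exceptional cases: `#Sel⁽²⁾(E_{pq}/ℚ) = 32` («`S̄` contains `8` elements») for primes
`p ≡ 1 (mod 8)`, `q ≡ 5, 7 (mod 8)` with `(p/q) = +1`** — the odd pair table's complementary count (kernel of `8`
elements, `s(pq) = 3`) and Monsky's odd formula with equality. UNCONDITIONAL.
[cite: Monsky1990MockHeegner, Remark (1) (pp. 66–67)] [cite: HeathBrown1994SelmerCongruentII, Appendix (Monsky), typescript p. 39 L10–L33] -/
theorem card_selmerGroup_two_eq_thirtytwo_odd_pair_exceptional {p q : ℕ} (hp : p.Prime) (hq : q.Prime)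
    (hp1 : p % 8 = 1) (hq8 : q % 8 = 5 ∨ q % 8 = 7) (hj : jacobiSym p q = 1) :
    Nat.card ((congruentNumberCurve (p * q)).selmerGroup 2) = 32 := by
  have hne : p ≠ q := fun h => by omega
  have hp2 : p ≠ 2 := by omega
  have hq2 : q ≠ 2 := by omega
  have ht : ∀ i, (![q, p] i).Prime := fun i => by fin_cases i <;> assumption
  have ht2 : ∀ i, (![q, p] i) ≠ 2 := fun i => by fin_cases i <;> assumption
  have hinj : Function.Injective ![q, p] := by
    intro i j hij
    fin_cases i <;> fin_cases j
    · rfl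
    · exact absurd hij.symm hne
    · exact absurd hij hne
    · rfl
  -- the kernel of Monsky's matrix has `8` elements (the census on the configuration `(q mod 8, 1; +1)`)
  have hker : Fintype.card {z : Fin 2 ⊕ Fin 2 → ZMod 2 // monskyMatrixOdd ![q, p] *ᵥ z = 0} = 8 := by
    rw [card_ker_monskyMatrixOdd_eq_cfg _ ht ht2 hinj]
    obtain ⟨r₀, r₁, ⟨e₀, e₁⟩, hRes, hB⟩ := cfg_two_eq ![q, p] ht ht2 hinj
    rw [hRes, hB]
    have hbit : kroneckerBit ((![q, p] : Fin 2 → ℕ) 1) ((![q, p] : Fin 2 → ℕ) 0) = 0 := by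
      simp only [Matrix.cons_val_zero, Matrix.cons_val_one]
      exact (kroneckerBit_of_jacobiSym hp hq hq2 hne).1 hj
    rw [hbit]
    have h8r : (r₀.val * r₁.val) % 8 = 5 ∨ (r₀.val * r₁.val) % 8 = 7 := by
      rw [e₀, e₁]
      simp only [Matrix.cons_val_zero, Matrix.cons_val_one]
      rw [← Nat.mul_mod, Nat.mul_mod, hp1]
      rcases hq8 with hq8 | hq8 <;> rw [hq8] <;> decide
    exact card_ker_monskyCfgOdd_two_eq_eight r₀ r₁ h8r (Or.inr (by rw [e₁]; exact hp1))
  have hs : monskySelmerRankOdd ![q, p] = 3 := monskySelmerRankOdd_eq_three_of_card_ker _ hker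
  have key : ∀ {M : ℕ}, (∏ i, (![q, p] : Fin 2 → ℕ) i) = M →
      Nat.card ((congruentNumberCurve M).selmerGroup 2) = 2 ^ (2 + monskySelmerRankOdd ![q, p]) := by
    intro M hM
    subst hM
    exact CongruentNumberOddMonskySelmerExact.card_selmerGroup_two_eq_pow ht ht2 hinj
  have hprod : (∏ i, (![q, p] : Fin 2 → ℕ) i) = p * q := by
    rw [Fin.prod_univ_two]
    simp only [Matrix.cons_val_zero, Matrix.cons_val_one]
    exact mul_comm q p
  rw [key hprod, hs]
  norm_num

/-- **Remark (1), the even exceptional cases: `#Sel⁽²⁾(E_{2pq}/ℚ) = 32`** for primes `p ≡ 1 (mod 8)`, `q ≡ 3 (mod 4)` with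
`(p/q) = +1` — the even row `s(2pq) = 3` and Monsky's even formula with equality. UNCONDITIONAL.
[cite: Monsky1990MockHeegner, Remark (1) (pp. 66–67)] [cite: HeathBrown1994SelmerCongruentII, Appendix (Monsky), typescript p. 41 L20–L36] -/
theorem card_selmerGroup_two_eq_thirtytwo_two_mul_one_pair_exceptional {p q : ℕ} (hp : p.Prime) (hq : q.Prime)
    (hp1 : p % 8 = 1) (hq4 : q % 4 = 3) (hj : jacobiSym p q = 1) :
    Nat.card ((congruentNumberCurve (2 * (p * q))).selmerGroup 2) = 32 := by
  have hne : p ≠ q := fun h => by omega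
  have ht : ∀ i, (![p, q] i).Prime := fun i => by fin_cases i <;> assumption
  have ht2 : ∀ i, (![p, q] i) ≠ 2 := by
    intro i
    fin_cases i
    · show p ≠ 2
      omega
    · show q ≠ 2
      omega
  have hinj : Function.Injective ![p, q] := by
    intro i j hij
    fin_cases i <;> fin_cases j
    · rfl
    · exact absurd hij hne
    · exact absurd hij.symm hne
    · rfl
  have hs : monskySelmerRankEven ![p, q] = 3 :=
    (monskySelmerRankEven_one_pair_of_jacobiSym_eq_one hp hq hp1 hq4 hj).1
  have h := CongruentNumberEvenMonskySelmerExact.card_selmerGroup_two_eq_pow ht ht2 hinj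
  rw [Fin.prod_univ_two] at h
  simp only [Matrix.cons_val_zero, Matrix.cons_val_one] at h
  rw [hs] at h
  exact h.trans (by norm_num)

/-- **MONSKY'S REMARK (1) AS A KERNEL THEOREM: in the four «exceptional cases» — `N = p₁p₅` with `(p₁/p₅) = 1`, `2p₁p₃` with
`(p₁/p₃) = 1`, `p₁p₇` with `(p₁/p₇) = 1`, `2p₁p₇` with `(p₁/p₇) = 1` — «`S̄` contains `8` elements», i.e. `#Sel⁽²⁾(E_N/ℚ) = 32`.**
UNCONDITIONAL («the patient reader may verify» discharged). [cite: Monsky1990MockHeegner, Remark (1) (pp. 66–67)]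
[cite: HeathBrown1994SelmerCongruentII, Appendix (Monsky), pp. 39–41] -/
theorem card_selmerGroup_two_eq_thirtytwo_of_exceptional {N : ℕ}
    (hN : (∃ p q : ℕ, p.Prime ∧ q.Prime ∧ p % 8 = 1 ∧ (q % 8 = 5 ∨ q % 8 = 7) ∧ jacobiSym p q = 1 ∧ N = p * q) ∨
      (∃ p q : ℕ, p.Prime ∧ q.Prime ∧ p % 8 = 1 ∧ (q % 8 = 3 ∨ q % 8 = 7) ∧ jacobiSym p q = 1 ∧ N = 2 * (p * q))) :
    Nat.card ((congruentNumberCurve N).selmerGroup 2) = 32 := by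
  rcases hN with ⟨p, q, hp, hq, hp1, hq8, hj, rfl⟩ | ⟨p, q, hp, hq, hp1, hq8, hj, rfl⟩
  · exact card_selmerGroup_two_eq_thirtytwo_odd_pair_exceptional hp hq hp1 hq8 hj
  · exact card_selmerGroup_two_eq_thirtytwo_two_mul_one_pair_exceptional hp hq hp1 (by omega) hj

end Summit.BirchSwinnertonDyer.Rank1Residual.P2

end
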